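import Mathlib
import Summits.PneNP.PneNP.Theorems.LatticeMagicBooleanSosBlindAtConstantFactorDefs

/-!
# PneNP / LatticeMagic — `BooleanSosBlindAtConstantFactor`, line `Sketch`: stub `stub_no`

Stub file (`--supports stmt-PneNP-2330`) for the crux line `Sketch` (Construction-A road) of
`Summit.PneNP.PneNP.Theses.LatticeMagic.BooleanSosBlindAtConstantFactor`. It proves the GEOMETRY stub
`stub_no` of the lead's skeleton: for a clause family `C : Fin me → Clause ℕ` over `N` variables whose
scope system is integer-parity unsatisfiable (`XorUnsat N me C`), the Construction-A instance
`conAInstance N me C d₀ = ((conABasis N me C, conATarget N me C), d₀)` of the landed Defs file is a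
NO-instance of `GapCVP` at factor `1` for every threshold `0 < d₀` with `d₀² < N + 1`:

* `det (conABasis N me C) = 2^N · 2^me ≠ 0` (block upper triangular basis
  `[[2·I_N, incBlock], [0, 2·I_me]]`);
* every lattice vector `z ᵥ* B` is at squared distance `≥ N + 1` from the target
  `t = (1, …, 1 | rhsBit (C e))`: the `N` message coordinates contribute the odd squares
  `(2 z_i − 1)² ≥ 1`, and the check coordinate `e₀` that `XorUnsat` supplies for `u = (z_i)_{i<N}`
  contributes `(Σ_i z_i [i ∈ scope (C e₀)] + 2 z_{N+e₀} − rhsBit (C e₀))² ≥ 1` (an odd integer squared);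
* hence `dist(t, L(B)) ≥ √(N+1) > d₀ = 1 · d₀`.

Sources for the construction: Conway–Sloane, *Sphere Packings, Lattices and Groups*, Construction A
(codes ↦ lattices `𝒞 + 2ℤⁿ`); Micciancio–Goldwasser 2002, *Complexity of Lattice Problems*, Ch. 1
(`GapCVP`, Defs. 1.1, 1.5). Everything below is elementary linear algebra over `ℤ` (Mathlib only);
no published fact is cited as an axiom.
-/

set_option linter.dupNamespace false -- `Summit.PneNP.PneNP.…`: summit = sub-problem (D-0017)

namespace Summit.PneNP.PneNP.Theorems.ConA

open scoped BigOperators Matrix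
open Literature.Algebra.EuclideanLattices Literature.Computability.Complexity
  Literature.Computability.MetaComplexity

variable {N me : ℕ} (C : Fin me → Clause ℕ)

/-! ## The determinant -/

/-- The Construction-A basis is block upper triangular with diagonal `2`, so
`det (conABasis N me C) = 2 ^ N · 2 ^ me`. (helper for stub `stub_no`) -/
private theorem stubNo_det_conABasis : (conABasis N me C).det = 2 ^ N * 2 ^ me := by
  simp only [conABasis, Matrix.det_reindex_self, Matrix.det_fromBlocks_zero₂₁, Matrix.det_diagonal,
    Finset.prod_const, Finset.card_univ, Fintype.card_fin]

/-! ## The coordinates of a lattice vector `z ᵥ* conABasis` and of the target, in block form -/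

/-- Message-block coordinate `i < N` of `z ᵥ* B`: `2 · z_i`. (helper for stub `stub_no`) -/
private theorem stubNo_vecMul_castAdd (z : Fin (N + me) → ℤ) (i : Fin N) :
    (z ᵥ* conABasis N me C) (Fin.castAdd me i) = z (Fin.castAdd me i) * 2 := by
  simp only [conABasis, Matrix.reindex_apply, Matrix.submatrix_vecMul_equiv, Equiv.symm_symm,
    Function.comp_apply, finSumFinEquiv_symm_apply_castAdd, Matrix.vecMul_fromBlocks, Sum.elim_inl,
    Matrix.vecMul_zero, add_zero, Matrix.vecMul_diagonal, finSumFinEquiv_apply_left]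

/-- Check-block coordinate `N + e` of `z ᵥ* B`: `Σ_i z_i · [i ∈ scope (C e)] + 2 · z_{N+e}`.
(helper for stub `stub_no`) -/
private theorem stubNo_vecMul_natAdd (z : Fin (N + me) → ℤ) (e : Fin me) :
    (z ᵥ* conABasis N me C) (Fin.natAdd N e) =
      (∑ i : Fin N, z (Fin.castAdd me i) * (if (i : ℕ) ∈ clauseScope (C e) then 1 else 0)) +
        z (Fin.natAdd N e) * 2 := by
  simp only [conABasis, Matrix.reindex_apply, Matrix.submatrix_vecMul_equiv, Equiv.symm_symm,
    Function.comp_apply, finSumFinEquiv_symm_apply_natAdd, Matrix.vecMul_fromBlocks, Sum.elim_inr,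
    Pi.add_apply, Matrix.vecMul_diagonal, finSumFinEquiv_apply_right]
  simp only [Matrix.vecMul_apply_eq_sum, Function.comp_apply, finSumFinEquiv_apply_left, incBlock,
    Matrix.of_apply]

/-- Message-block coordinate of the target: `1`. (helper for stub `stub_no`) -/
private theorem stubNo_target_castAdd (i : Fin N) : conATarget N me C (Fin.castAdd me i) = 1 := by
  simp [conATarget]

/-- Check-block coordinate of the target: `rhsBit (C e)`. (helper for stub `stub_no`) -/
private theorem stubNo_target_natAdd (e : Fin me) :
    conATarget N me C (Fin.natAdd N e) = rhsBit (C e) := by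
  simp [conATarget]

/-! ## The integer inequality -/

/-- **Key integer inequality.** Under integer-parity unsatisfiability, every lattice vector
`z ᵥ* B` is at squared distance `≥ N + 1` from the target: each of the `N` message coordinates
contributes the square of the odd integer `2 z_i − 1`, and the check coordinate `e₀` supplied by
`XorUnsat` for `u = (z_i)_{i<N}` contributes the square of an odd integer. (helper for stub
`stub_no`) -/
private theorem stubNo_key (hX : XorUnsat N me C) (z : Fin (N + me) → ℤ) :
    (N : ℤ) + 1 ≤ ∑ k, ((z ᵥ* conABasis N me C) k - conATarget N me C k) ^ 2 := by
  rw [Fin.sum_univ_add]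
  have h1 : ∀ i : Fin N, (1 : ℤ) ≤
      ((z ᵥ* conABasis N me C) (Fin.castAdd me i) - conATarget N me C (Fin.castAdd me i)) ^ 2 := by
    intro i
    rw [stubNo_vecMul_castAdd, stubNo_target_castAdd]
    exact (one_le_sq_iff_one_le_abs _).mpr (Int.one_le_abs (by omega))
  have h2 : (1 : ℤ) ≤ ∑ e : Fin me,
      ((z ᵥ* conABasis N me C) (Fin.natAdd N e) - conATarget N me C (Fin.natAdd N e)) ^ 2 := by
    obtain ⟨e₀, he₀⟩ := hX fun i => z (Fin.castAdd me i)
    refine le_trans ?_ (Finset.single_le_sum (fun e _ => sq_nonneg _) (Finset.mem_univ e₀))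
    rw [stubNo_vecMul_natAdd, stubNo_target_natAdd]
    refine (one_le_sq_iff_one_le_abs _).mpr (Int.one_le_abs fun h => he₀ ⟨-z (Fin.natAdd N e₀), ?_⟩)
    linarith
  have h0 : (N : ℤ) ≤ ∑ i : Fin N,
      ((z ᵥ* conABasis N me C) (Fin.castAdd me i) - conATarget N me C (Fin.castAdd me i)) ^ 2 :=
    le_trans (by simp) (Finset.sum_le_sum fun i _ => h1 i)
  exact add_le_add h0 h2

/-! ## The distance bound -/

/-- `√(N + 1) ≤ dist(t, L(B))` for the Construction-A instance under integer-parity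
unsatisfiability. (helper for stub `stub_no`) -/
private theorem stubNo_sqrt_le_infDist (hX : XorUnsat N me C) (d₀ : ℚ) :
    √((N : ℝ) + 1) ≤ Metric.infDist (conAInstance N me C d₀).1.targetE
      (conAInstance N me C d₀).1.I.lattice := by
  refine (Metric.le_infDist ⟨0, zero_mem _⟩).2 fun x hx => ?_
  obtain ⟨z, rfl⟩ := (LatticeInstance.mem_lattice_iff _ x).1 hx
  rw [dist_eq_norm]
  change √((N : ℝ) + 1) ≤ ‖intVecToEuclidean (N + me) (conATarget N me C) -
    intVecToEuclidean (N + me) (z ᵥ* conABasis N me C)‖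
  rw [← map_sub, norm_intVecToEuclidean]
  refine Real.sqrt_le_sqrt ?_
  have h : (((N : ℤ) + 1 : ℤ) : ℝ) ≤
      ((∑ k, ((z ᵥ* conABasis N me C) k - conATarget N me C k) ^ 2 : ℤ) : ℝ) :=
    Int.cast_le.2 (stubNo_key C hX z)
  push_cast at h
  refine h.trans_eq (Finset.sum_congr rfl fun k _ => ?_)
  rw [Pi.sub_apply, Int.cast_sub]
  ring

/-! ## The stub -/

/-- **Stub `stub_no`.** Integer-parity unsatisfiability makes the Construction-A instance a
NO-instance of `GapCVP_1` for every threshold `0 < d₀` with `d₀² < N + 1`: `det B = 2^(N+me) ≠ 0`,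
and every lattice vector `z ᵥ* B` has `‖z ᵥ* B − t‖² ≥ N + 1 > d₀²`. (Conway–Sloane Construction A;
Micciancio–Goldwasser 2002, Ch. 1.) -/
theorem stub_no {N me : ℕ} (C : Fin me → Clause ℕ) (hX : XorUnsat N me C) (d₀ : ℚ) (hd0 : 0 < d₀)
    (hdN : (d₀ : ℝ) ^ 2 < N + 1) : conAInstance N me C d₀ ∈ GapCVP.no (fun _ => (1 : ℝ)) := by
  refine ⟨?_, hd0, ?_⟩
  · change (conABasis N me C).det ≠ 0
    rw [stubNo_det_conABasis]
    positivity
  · refine lt_of_eq_of_lt (one_mul _) ?_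
    have h1 : ((d₀ : ℚ) : ℝ) < √((N : ℝ) + 1) := (Real.lt_sqrt (by exact_mod_cast hd0.le)).2 hdN
    exact h1.trans_le (stubNo_sqrt_le_infDist C hX d₀)

end Summit.PneNP.PneNP.Theorems.ConA
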